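import Literature.NumberTheory.PAdicHodge.AinfWeierstrassTateModuleIntegersSS
import Literature.RingTheory.PowerSeries.WeierstrassFactorizationRoots
import Literature.NumberTheory.EllipticCurves.FormalGroupVerschiebungHasseZeroProofs
import Literature.NumberTheory.EllipticCurves.TorsionPointsAlgebraic
import HarnessLib

/-!
# A `p`-torsion point OUTSIDE the canonical subgroup for the `𝒪_F`-model at good supersingular reduction (ramified coefficients)
# (proofs only)

Topic `Literature/NumberTheory/PAdicHodge`; namespace `Literature.NumberTheory.PAdicHodge.AinfTop`. THEOREMS ONLY (no definition, no
named fact, no instance, no `sorry`).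

For the `𝒪_F`-MODEL `W` (coefficients in the discrete copy `LTCoeff F` of `𝒪_F`, file `AinfWeierstrassTateModuleIntegers`) of a
`p`-adic field `F` of ANY ramification, with supersingular reduction of exact height `2` (`A_p(W mod 𝔪_F) = 0`,
`[X^{p²}][p]˜ ≠ 0`), and a set `S ⊂ 𝔪_{ℂ_F}` of `p²` DISTINCT zeros of the multiplication-by-`p` series `[p]_W` containing `0`
(e.g. the `z`-coordinates of `E[p] ⊂ Ŵ(𝔪_{ℂ_F})`):

* **`exists_norm_p_le_norm_pow_of_roots`** — some `s ∈ S ∖ 0` has `‖p‖ ≤ ‖s‖^{p²−1}`, hence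
  **`exists_norm_p_lt_norm_pow_of_roots`** — `‖p‖ < ‖s‖^p` (the point condition of the η-Hasse criterion);
* **`exists_roots_finset_of_goodSupersingular`** — the set `S` EXISTS for the good model (`Δ ∈ 𝒪_Fˣ`, `A_p = 0`, `p` odd): the
  `z`-coordinates of the image of `E(F̄)[p]` (`#E[p] = p²`) in `E₁(ℂ_F) ≅ Ŵ(𝔪_{ℂ_F})`; hence
  **`exists_torsionPt_norm_p_lt_norm_pow`**: some `u ∈ 𝔪_{ℂ_F}` with `[p]_W(u) = 0` has `‖p‖ < ‖u‖^p` (exact height `2` of the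
  reduction as the remaining hypothesis — automatic when `𝓀_F = 𝔽_p`, `p ≥ 5`).

PROOF: Weierstrass preparation of `[p]_W ∈ 𝒪_F⟦X⟧` (Mathlib `PowerSeries.exists_isWeierstrassFactorization`, `𝒪_F` complete):
`[p] = f·h`, `f` distinguished of degree `p²` (= the order of `[p]˜`), `h` a unit; every zero `u ∈ 𝔪_{ℂ_F}` of `[p]` is a root of `f`
(`h(u) ∈ 𝒪_ℂˣ`); so `f = ∏_{s∈S}(X − s)` and `∏_{s≠0}‖s‖ = ‖[X¹][p]‖ = ‖p‖` (tree `Literature.RingTheory.PowerSeries.prod_norm_eq_norm_coeff_one`).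
Why (BSD route EdixhovenFibreFiveSeven, crux K★ `stmt-BirchSwinnertonDyer-22226`, road item (R1), memo
`Lines/kato-lever-hDR-R1-torsion-witness.md`): over a RAMIFIED base the coefficients `[Xʲ][p]`, `p ∣ j < p²`, are only divisible by the
uniformizer, not by `p`, so "every non-zero `p`-torsion point satisfies `‖p‖ < ‖u‖^p`" (true for `ℤ`-models,
`norm_p_lt_norm_pow_of_mulPC_eq_zero`) FAILS on the canonical subgroup; the product of the roots still forces ONE good point.
BSD is not proved by any of this.

## References
* J.-P. Serre, *Propriétés galoisiennes des points d'ordre fini des courbes elliptiques*, Invent. Math. 15 (1972), §1.11. [Serre1972]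
* L. C. Washington, *Introduction to Cyclotomic Fields* (1997), Thm. 7.3. [Washington1997]
* J. H. Silverman, *The Arithmetic of Elliptic Curves* (2009), IV.7.5, VII.2.2. [SilvermanAEC2009]
-/

noncomputable section

open scoped Classical NNReal
open Field ValuativeRel Polynomial

namespace Literature.NumberTheory.PAdicHodge

open Literature.NumberTheory.GaloisRepresentations
open Literature.NumberTheory.GaloisRepresentations.IsNonarchimedeanLocalField
open Literature.NumberTheory.GaloisRepresentations.LubinTate
open Literature.NumberTheory.EllipticCurves Literature.NumberTheory.EllipticCurves.FormalGroupChart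
open Literature.RingTheory.PowerSeries

namespace AinfTop

variable {F : Type} [Field F] [ValuativeRel F] [TopologicalSpace F] [IsNonarchimedeanLocalField F]
  {p : ℕ} [Fact p.Prime] (W : WeierstrassCurve (LTCoeff F))

/-- The coefficient embedding `𝒪_F → ℂ_F` (through `LTCoeff F → 𝒪_{ℂ_F} ⊂ ℂ_F`) has norm `≤ 1`. [cite: SilvermanAEC2009, VII.§1] -/
theorem norm_coeffEmb_le_one (a : 𝒪[F]) :
    ‖(((CBall F).subtype.comp ((algebraMap (LTCoeff F) (CBall F)).comp (LTCoeff.of F).toRingHom)) a : CompletedAlgClosure F)‖ ≤ 1 := by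
  change ‖((algebraMap (LTCoeff F) (CBall F) (LTCoeff.of F a) : CBall F) : CompletedAlgClosure F)‖ ≤ 1
  rw [coe_algebraMap_ltCoeff, RingEquiv.symm_apply_apply, CompletedAlgClosure.norm_algebraMap, norm_le_one_iff]
  exact a.2

/-- **The multiplication-by-`p` series of the `𝒪_F`-model reduces to a series of order exactly `p²`** at supersingular reduction of
exact height `2` (`A_p(W mod 𝔪) = 0` kills `[Xʲ][p]˜` for `p² ∤ j`; `[X^{p²}][p]˜ ≠ 0`). [cite: SilvermanAEC2009, IV.7.5] -/
theorem order_map_formalMul_prime [CharP 𝓀[F] p] (hp2 : p ≠ 2) (hA : (W.map (redCoeff F)).hasseCoeff p = 0)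
    (hht : PowerSeries.coeff (p ^ 2) ((W.map (redCoeff F)).formalMul p) ≠ 0) :
    (((W.map (LTCoeff.of F).symm.toRingHom).formalMul p).map (IsLocalRing.residue 𝒪[F])).order = (p ^ 2 : ℕ) := by
  have hred : ((W.map (LTCoeff.of F).symm.toRingHom).formalMul p).map (IsLocalRing.residue 𝒪[F]) =
      (W.map (redCoeff F)).formalMul p := by
    rw [WeierstrassCurve.map_formalMul, WeierstrassCurve.map_map]
    rfl
  rw [hred, PowerSeries.order_eq_nat]
  refine ⟨hht, fun i hi => ?_⟩
  rcases Nat.eq_zero_or_pos i with rfl | hi0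
  · rw [PowerSeries.coeff_zero_eq_constantCoeff, WeierstrassCurve.constantCoeff_formalMul]
  · exact (W.map (redCoeff F)).coeff_formalMul_prime_eq_zero_of_hasseCoeff_eq_zero p hp2 hA
      fun h => absurd (Nat.le_of_dvd hi0 h) (not_le.mpr hi)

/-- **A `p`-torsion point with `‖p‖ ≤ ‖u‖^{p²−1}`** for the `𝒪_F`-model (any ramification): given `p²` distinct zeros `S ∋ 0` of `[p]_W`
in `𝔪_{ℂ_F}` and supersingular reduction of exact height `2`, some `s ∈ S ∖ 0` has `‖p‖ ≤ ‖s‖^{p²−1}` — Weierstrass preparation and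
the product of the roots (`∏_{s≠0}‖s‖ = ‖p‖`). [cite: Serre1972, §1.11] [cite: Washington1997, Thm. 7.3] -/
theorem exists_norm_p_le_norm_pow_of_roots [CharP 𝓀[F] p] (hp2 : p ≠ 2) (hA : (W.map (redCoeff F)).hasseCoeff p = 0)
    (hht : PowerSeries.coeff (p ^ 2) ((W.map (redCoeff F)).formalMul p) ≠ 0)
    (S : Finset (CompletedAlgClosure F)) (hS0 : (0 : CompletedAlgClosure F) ∈ S) (hcard : S.card = p ^ 2)
    (hS : ∀ s ∈ S, ∃ u : (maxNilIdealC F).toIdeal, ((u : CBall F) : CompletedAlgClosure F) = s ∧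
      (evalPt₁ (maxNilIdealC F) (W.formalMul p) (W.constantCoeff_formalMul p) u : CBall F) = 0) :
    ∃ s ∈ S.erase 0, ‖(p : CompletedAlgClosure F)‖ ≤ ‖s‖ ^ (p ^ 2 - 1) := by
  have hp : p.Prime := Fact.out
  -- Weierstrass preparation of `[p]` over the complete local ring `𝒪_F`
  letI := IsTopologicalAddGroup.rightUniformSpace F
  haveI := isUniformAddGroup_of_addCommGroup (G := F)
  haveI : IsAdicComplete 𝓂[F] 𝒪[F] := inferInstance
  have hord := order_map_formalMul_prime W hp2 hA hht
  set ρ : LTCoeff F ≃+* 𝒪[F] := (LTCoeff.of F).symm with hρ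
  set g : PowerSeries 𝒪[F] := (W.map ρ.toRingHom).formalMul p with hg
  have hgne : g.map (IsLocalRing.residue 𝒪[F]) ≠ 0 := by
    intro h0
    have h := hord
    rw [h0, PowerSeries.order_zero] at h
    exact ENat.top_ne_coe _ h
  obtain ⟨f, h, H⟩ := g.exists_isWeierstrassFactorization hgne
  have hdeg : f.natDegree = p ^ 2 := by
    rw [H.natDegree_eq_toNat_order_map, hord, ENat.toNat_coe]
  -- the coefficient embedding `ι : 𝒪_F → ℂ_F`
  set ι : 𝒪[F] →+* CompletedAlgClosure F :=
    (CBall F).subtype.comp ((algebraMap (LTCoeff F) (CBall F)).comp (LTCoeff.of F).toRingHom) with hι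
  have hιle : ∀ a, ‖ι a‖ ≤ 1 := norm_coeffEmb_le_one
  -- `[X⁰]g = 0`, `ι([X¹]g) = p`
  have hg0 : PowerSeries.constantCoeff g = 0 := (W.map ρ.toRingHom).constantCoeff_formalMul p
  have hg1 : ι (PowerSeries.coeff 1 g) = (p : CompletedAlgClosure F) := by
    rw [hg, WeierstrassCurve.coeff_one_formalMul', map_natCast]
  -- `[p]_W = f·h` read back over `LTCoeff F`
  have hmapg : PowerSeries.map ρ.symm.toRingHom g = W.formalMul p := by
    ext n
    rw [PowerSeries.coeff_map, hg, ← WeierstrassCurve.map_formalMul, PowerSeries.coeff_map]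
    exact ρ.symm_apply_apply _
  have hfac : W.formalMul p = ((f.map ρ.symm.toRingHom : (LTCoeff F)[X]) : PowerSeries (LTCoeff F)) *
      PowerSeries.map ρ.symm.toRingHom h := by
    rw [← hmapg, H.eq_mul, map_mul, Polynomial.polynomial_map_coe]
  -- every zero of `[p]` in `𝔪_ℂ` is a root of `f`
  have hroots : ∀ s ∈ S, (f.map ι).IsRoot s := by
    intro s hs
    obtain ⟨u, hus, hu⟩ := hS s hs
    have hx := (maxNilIdealC F).isTopologicallyNilpotent _ u.2
    have heval : (evalPt₁ (maxNilIdealC F) (W.formalMul p) (W.constantCoeff_formalMul p) u : CBall F) =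
        PowerSeries.aeval hx (W.formalMul p) := coe_evalPt₁ _ _ _ _
    rw [heval, hfac, map_mul, PowerSeries.aeval_coe] at hu
    have hunit : IsUnit (PowerSeries.aeval hx (PowerSeries.map ρ.symm.toRingHom h)) :=
      ((H.isUnit.map (PowerSeries.map ρ.symm.toRingHom)).map _)
    have hpoly : Polynomial.aeval ((u : CBall F)) (f.map ρ.symm.toRingHom) = 0 := (hunit.mul_left_eq_zero).mp hu
    have h2 := congrArg ((CBall F).subtype) hpoly
    rw [map_zero, Polynomial.aeval_def, Polynomial.eval₂_map, Polynomial.hom_eval₂] at h2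
    rw [Polynomial.IsRoot, Polynomial.eval_map, ← hus]
    exact h2
  -- the product of the roots
  obtain ⟨s, hs, hle⟩ := exists_norm_coeff_one_le_norm_pow ι hιle H hg0 S hS0 (hcard.trans hdeg.symm) hroots
    (by rw [hdeg]; nlinarith [hp.two_le])
  refine ⟨s, hs, ?_⟩
  rwa [hg1, hdeg] at hle

/-- **A `p`-torsion point outside the canonical subgroup: `‖p‖ < ‖u‖^p`** (same hypotheses): from `‖p‖ ≤ ‖u‖^{p²−1}`,
`‖u‖ < 1`, `u ≠ 0` and `p < p² − 1`. [cite: Serre1972, §1.11] -/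
theorem exists_norm_p_lt_norm_pow_of_roots [CharZero F] [CharP 𝓀[F] p] (hp2 : p ≠ 2)
    (hA : (W.map (redCoeff F)).hasseCoeff p = 0)
    (hht : PowerSeries.coeff (p ^ 2) ((W.map (redCoeff F)).formalMul p) ≠ 0)
    (S : Finset (CompletedAlgClosure F)) (hS0 : (0 : CompletedAlgClosure F) ∈ S) (hcard : S.card = p ^ 2)
    (hS : ∀ s ∈ S, ∃ u : (maxNilIdealC F).toIdeal, ((u : CBall F) : CompletedAlgClosure F) = s ∧
      (evalPt₁ (maxNilIdealC F) (W.formalMul p) (W.constantCoeff_formalMul p) u : CBall F) = 0) :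
    ∃ s ∈ S.erase 0, ‖s‖ < 1 ∧ ‖(p : CompletedAlgClosure F)‖ < ‖s‖ ^ p := by
  have hp : p.Prime := Fact.out
  obtain ⟨s, hs, hle⟩ := exists_norm_p_le_norm_pow_of_roots W hp2 hA hht S hS0 hcard hS
  obtain ⟨hs0, hsS⟩ := Finset.mem_erase.mp hs
  obtain ⟨u, hus, _⟩ := hS s hsS
  have hs1 : ‖s‖ < 1 := by rw [← hus]; exact u.2
  have hspos : 0 < ‖s‖ := norm_pos_iff.mpr hs0
  refine ⟨s, hs, hs1, hle.trans_lt (pow_lt_pow_right_of_lt_one₀ hspos hs1 ?_)⟩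
  have : p + 1 < p ^ 2 := by nlinarith [hp.two_le]
  omega

/-! ## The set of `p`-torsion zeros from `E(F̄)[p]` -/

/-- `(W ⊗ F) ⊗ F̄ ⊗ ℂ_F = W ⊗ ℂ_F` (`curveOver`): the coefficient embeddings `𝒪_F → F → F̄ → ℂ_F` and `𝒪_F → 𝒪_{ℂ_F} → ℂ_F` agree.
[cite: SilvermanAEC2009, III.§1] -/
theorem baseChange_map_algClosureToC_eq_curveOver :
    ((W.map (algebraMap (LTCoeff F) F)).baseChange (AlgebraicClosure F)).map (algClosureToC F) =
      curveOver (CompletedAlgClosure F) W := by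
  rw [WeierstrassCurve.baseChange, WeierstrassCurve.map_map, WeierstrassCurve.map_map, curveOver, ballIntModel,
    WeierstrassCurve.baseChange, WeierstrassCurve.map_map]
  congr 1

/-- **The `p`-torsion zeros of `[p]_W` in `𝔪_{ℂ_F}`**: for the good model (`Δ ∈ 𝒪_Fˣ`) with supersingular reduction at the odd residue
characteristic `p`, there is a set `S ⊂ ℂ_F` of `p²` DISTINCT zeros of `[p]_W` in `𝔪_{ℂ_F}`, containing `0`: the `z`-coordinates of
`E(F̄)[p] ↪ E(ℂ_F)[p] ⊂ E₁(ℂ_F) ≅ Ŵ(𝔪_{ℂ_F})` (`#E(F̄)[p] = p²`, AEC III.6.4; `E[p] ⊂ E₁` at supersingular reduction, VII.2.2).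
[cite: SilvermanAEC2009, Cor. III.6.4] [cite: SilvermanAEC2009, Prop. VII.2.2] -/
theorem exists_roots_finset_of_goodSupersingular [CharZero F] [CharP 𝓀[F] p] (hp2 : p ≠ 2) (hΔ : IsUnit W.Δ)
    (hA : (W.map (redCoeff F)).hasseCoeff p = 0) :
    ∃ S : Finset (CompletedAlgClosure F), (0 : CompletedAlgClosure F) ∈ S ∧ S.card = p ^ 2 ∧
      ∀ s ∈ S, ∃ u : (maxNilIdealC F).toIdeal, ((u : CBall F) : CompletedAlgClosure F) = s ∧
        (evalPt₁ (maxNilIdealC F) (W.formalMul p) (W.constantCoeff_formalMul p) u : CBall F) = 0 := by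
  have hp : p.Prime := Fact.out
  haveI hEC : (curveOver (CompletedAlgClosure F) W).IsElliptic := isElliptic_curveOverC_O (F := F) hΔ
  set EF : WeierstrassCurve F := W.map (algebraMap (LTCoeff F) F) with hEF
  haveI : EF.IsElliptic := ⟨by rw [hEF, WeierstrassCurve.map_Δ]; exact hΔ.map _⟩
  set Eb : WeierstrassCurve (AlgebraicClosure F) := EF.baseChange (AlgebraicClosure F) with hEb
  haveI : CharZero (AlgebraicClosure F) :=
    charZero_of_injective_algebraMap (algebraMap F (AlgebraicClosure F)).injective
  have hpK : ((p : ℕ) : AlgebraicClosure F) ≠ 0 := Nat.cast_ne_zero.mpr hp.ne_zero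
  -- the `p`-torsion of `E(F̄)`: `p²` points
  set T := AddSubgroup.torsionBy Eb.toAffine.Point (p : ℤ) with hT
  have hcard : Nat.card T = p ^ 2 := WeierstrassCurve.card_torsionBy_eq_sq (E := Eb) hpK
  haveI : Finite T := Nat.finite_of_card_ne_zero (by rw [hcard]; exact pow_ne_zero _ hp.ne_zero)
  haveI : Fintype T := Fintype.ofFinite T
  -- `E(F̄) → E(ℂ_F)` and the kernel of reduction
  have hbar := baseChange_map_algClosureToC_eq_curveOver W
  set ψ : Eb.toAffine.Point →+ (curveOver (CompletedAlgClosure F) W).toAffine.Point :=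
    (WeierstrassCurve.Affine.Point.congrEquiv hbar).toAddMonoidHom.comp (Eb.mapPointHom (algClosureToC F)) with hψ
  have hψinj : Function.Injective ψ :=
    (WeierstrassCurve.Affine.Point.congrEquiv hbar).injective.comp (WeierstrassCurve.mapPointHom_injective _ _)
  have hker : ∀ P : T, ψ P.1 ∈ kernel (NormedField.valuation (K := CompletedAlgClosure F)) (curveOver (CompletedAlgClosure F) W) :=
    fun P => mem_kernel_of_pow_prime_smul_eq_zero_ssO hp2 hΔ hA 1 (ψ P.1) (by
      rw [pow_one, ← map_nsmul, AddSubgroup.torsionBy.nsmul_iff.mp P.2, map_zero])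
  -- the `z`-coordinates
  set φ : T → CompletedAlgClosure F := fun P => (ψ P.1).zCoord with hφ
  have hφinj : Function.Injective φ := by
    intro P Q hPQ
    have h1 : kernelEquivPt (CompletedAlgClosure F) W ⟨ψ P.1, hker P⟩ = kernelEquivPt (CompletedAlgClosure F) W ⟨ψ Q.1, hker Q⟩ := by
      apply WeierstrassCurve.Pt.ext
      rw [kernelEquivPt_apply_val, kernelEquivPt_apply_val]
      exact Subtype.ext (Subtype.ext hPQ)
    have h2 := congrArg Subtype.val ((kernelEquivPt (CompletedAlgClosure F) W).injective h1)
    exact Subtype.ext (hψinj h2)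
  refine ⟨Finset.univ.image φ, ?_, ?_, ?_⟩
  · refine Finset.mem_image.mpr ⟨⟨0, (AddSubgroup.torsionBy Eb.toAffine.Point (p : ℤ)).zero_mem⟩, Finset.mem_univ _, ?_⟩
    simp only [hφ, map_zero, WeierstrassCurve.Affine.Point.zCoord_zero]
  · rw [Finset.card_image_of_injective _ hφinj, Finset.card_univ, ← Nat.card_eq_fintype_card, hcard]
  · intro s hs
    obtain ⟨P, -, rfl⟩ := Finset.mem_image.mp hs
    refine ⟨zPt (ψ P.1) (hker P), rfl, ?_⟩
    -- `[p](z(ψ P)) = z(p • ψ P) = z(O) = 0`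
    have hnsmul : p • (⟨ψ P.1, hker P⟩ : kernel (NormedField.valuation (K := CompletedAlgClosure F))
        (curveOver (CompletedAlgClosure F) W)) = 0 := by
      apply Subtype.ext
      rw [AddSubmonoidClass.coe_nsmul, ZeroMemClass.coe_zero, ← map_nsmul, AddSubgroup.torsionBy.nsmul_iff.mp P.2, map_zero]
    have h := congrArg WeierstrassCurve.Pt.val (congrArg (kernelEquivPt (CompletedAlgClosure F) W) hnsmul)
    rw [map_nsmul, map_zero, WeierstrassCurve.Pt.val_nsmul, kernelEquivPt_apply_val, WeierstrassCurve.Pt.val_zero] at h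
    exact congrArg Subtype.val h

/-- **A `p`-torsion point of `Ŵ(𝔪_{ℂ_F})` outside the canonical subgroup, for the `𝒪_F`-model** (any ramification of `F`): for the good
model `W` (`Δ ∈ 𝒪_Fˣ`) with supersingular reduction of exact height `2` at the odd residue characteristic `p`, some `u ∈ 𝔪_{ℂ_F}` with
`[p]_W(u) = 0` has `‖u‖ < 1` and `‖p‖ < ‖u‖^p`. (Input of the η-transversality for the ramified good models of the potentially
supersingular Kodaira cells; `[X^{p²}][p]˜ ≠ 0` holds automatically when `𝓀_F = 𝔽_p`, `p ≥ 5`.) [cite: Serre1972, §1.11]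
[cite: SilvermanAEC2009, Prop. VII.2.2] -/
theorem exists_torsionPt_norm_p_lt_norm_pow [CharZero F] [CharP 𝓀[F] p] (hp2 : p ≠ 2) (hΔ : IsUnit W.Δ)
    (hA : (W.map (redCoeff F)).hasseCoeff p = 0) (hht : PowerSeries.coeff (p ^ 2) ((W.map (redCoeff F)).formalMul p) ≠ 0) :
    ∃ u : (maxNilIdealC F).toIdeal, (evalPt₁ (maxNilIdealC F) (W.formalMul p) (W.constantCoeff_formalMul p) u : CBall F) = 0 ∧
      ((u : CBall F) : CompletedAlgClosure F) ≠ 0 ∧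
      ‖(p : CompletedAlgClosure F)‖ < ‖((u : CBall F) : CompletedAlgClosure F)‖ ^ p := by
  obtain ⟨S, hS0, hcard, hS⟩ := exists_roots_finset_of_goodSupersingular W hp2 hΔ hA
  obtain ⟨s, hs, -, hlt⟩ := exists_norm_p_lt_norm_pow_of_roots W hp2 hA hht S hS0 hcard hS
  obtain ⟨hs0, hsS⟩ := Finset.mem_erase.mp hs
  obtain ⟨u, hus, hu⟩ := hS s hsS
  exact ⟨u, hu, by rwa [hus], by rwa [hus]⟩

end AinfTop

end Literature.NumberTheory.PAdicHodge

end
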